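import Summits.CriticalPhenomena.PercolationContinuityZ3.Theorems.Transplant.KNLevelsStepIV
import HarnessLib

/-!
# Kozma–Nitzan Lemma 10, STEP IV with the TWO-SCALE KIT of route D″ v2 (P4-GENERAL §16.4 (U1′), (e1′); DPRIME-SCOPE §2 L5′ "two-scale Step-IV kit"):
# the relay face `U` may lie OUTSIDE the uniqueness-zone box `Λ n`, linked from the seed inside a pinned KIT REGION `Qk ⊇ Λ n`
# — φ-free engine lemma, a one-block generalisation of `KNLevels.stepIV_in`

builds on p205010 (kernel theorem, internal audit signed; external expert review pending) — nothing in this file uses p205010.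
Lane `prim-bschramm`, seat `prim-bschramm-p3` (gen 7; D″ design owner); helper file (`--supports stmt-CriticalPhenomena-4575`).
WHY.  In the node of record the kit behind a contact is the square fat prism `Λ n = fatSeq c M` whose quarter-face `U ⊆ ∂^{in} Λ n` is certified by
Lemma 9 under `D₄` (`stepIV_in`: `hU : U ⊆ innerBoundary G (Λ n)`, `h2 : linkIn (Λ n) (Λ k) U`).  Under `(ℤ/2)²` a face of the SQUARE is not
certified (only one axis pair of `R(M, M)` is, `TwoAxisSteering.key_ineq`); what is certified is the directed near side of the BAND RECTANGLE
`R(M_u + 1, G(M_u + 1))`, which sits at skeleton distance `M_u + 1`, just OUTSIDE the zone box of scale `M_u` (P4-GENERAL §16.4 (e1′): "KN's single `M`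
splits into `M_u` and `M_S`").  So here `U` is any set DISJOINT from `Λ n`, linked from `Λ k` inside a kit region `Qk` with `Λ n ⊆ Qk ⊆ S ∩ D` (pinned
and lattice): the arm `x₀ ↔ u₀` inside `Qk` exits `Λ n` through an edge of `G`, so `x₀ ↔ ∂^{in} Λ n` inside `Λ n` exactly as the route to `Ft` gives
`x' ↔ ∂^{in} Λ n`, and the uniqueness zone glues the two — the rest of the proof is `stepIV_in` verbatim.
* **`stepIV_out`**: `IsSubbox G W p D`, `Ft ⊆ T`, `Qt ⊆ D`, `Λ k ⊆ Λ n ⊆ Qk ⊆ S`, `Qk ⊆ D`, `Disjoint U (Λ n)`, `Disjoint Ft (Λ n)`, `δ > 0`, `Rg ⊇ Qk ∪ Qt`;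
  with `prodBernoulli W`-probability `> 1 − δ²` each: `zone Λ k n`, `linkIn Qk (Λ k) U`, `linkIn Qt (Λ k) Ft`; THEN with probability `≥ 1 − 3δ` some
  `u ∈ U` has `P(u ↔ T inside Rg | ω|_{E(S)}) > 1 − δ`;  `stepIV_out'` (= `stepIV` shape, `Rg = univ`, `GoodVertex`).
[cite: KozmaNitzan2024, §4 Lemma 10, pp. 19–21 (Step IV, (21)–(25)); p. 16 (definition of a target)] [cite: GrimmettPercolation1999, §7.2]
-/

noncomputable section

open MeasureTheory ProbabilityTheory
open scoped ENNReal

namespace Summit.CriticalPhenomena.PercolationContinuityZ3.Theorems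

namespace Transplant

namespace KNLevels

open Literature.Probability.Percolation Literature.Probability.LatticeModels SimpleGraph

variable {V : Type*} [DecidableEq V] {G : SimpleGraph V} [G.LocallyFinite]

/-- **Step IV with the two-scale kit** (relay face outside the zone box, linked inside a pinned kit region `Qk ⊇ Λ n`): see the module docstring.
[cite: KozmaNitzan2024, §4 pp. 19–21 (Step IV, (21)–(25)); p. 16 (definition of a target)] -/
theorem stepIV_out {W : Sym2 V → unitInterval} {p : unitInterval} {D S T U Qk Qt Ft : Finset V}
    (hW : IsSubbox G W p D) (hT : Ft ⊆ T) (hQt : Qt ⊆ D) (Λ : ℕ → Finset V) {k n : ℕ} (hkn : Λ k ⊆ Λ n)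
    (hQkD : Qk ⊆ D) (hQkS : Qk ⊆ S) (hΛQk : Λ n ⊆ Qk) (hUfar : Disjoint U (Λ n))
    (hfar : Disjoint Ft (Λ n)) {δ : ℝ} (hδ : 0 < δ) {Rg : Set V}
    (hRb : (↑Qk : Set V) ⊆ Rg) (hRQ : (↑Qt : Set V) ⊆ Rg)
    (h1 : 1 - δ ^ 2 < (prodBernoulli W).real (UniqZone.zone G Λ k n))
    (h2 : 1 - δ ^ 2 < (prodBernoulli W).real (linkIn (↑Qk) (Λ k) U))
    (h3 : 1 - δ ^ 2 < (prodBernoulli W).real (linkIn (↑Qt) (Λ k) Ft)) :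
    1 - 3 * δ ≤ (prodBernoulli W).real {ω | ∃ u ∈ U,
      1 - δ < (prodBernoulli (pinW W (wireSet (↑S : Set V)) ω)).real
        (⋃ t ∈ T, openConnIn Rg u t)} := by
  classical
  -- trivial when `δ > 1`
  rcases le_or_gt δ 1 with hδ1 | hδ1
  swap
  · exact le_trans (by linarith) measureReal_nonneg
  set μ := prodBernoulli W with hμ
  -- the good event `𝒢`
  set Gd : Set (BondConfig V) := UniqZone.zone G Λ k n ∩ linkIn (↑Qk) (Λ k) U ∩
    linkIn (↑Qt) (Λ k) Ft ∩ lattOnly G D with hGd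
  have hGm : MeasurableSet Gd := by
    refine (((measurableSet_zone Λ k n).inter (measurableSet_linkIn _ _ _)).inter
      (measurableSet_linkIn _ _ _)).inter ?_
    refine (DeterminedBy.measurableSet_of_finset (F := pairsF D) ?_)
    rw [determinedBy_iff]
    intro ω ω' hω
    simp only [lattOnly, Set.mem_setOf_eq]
    refine forall₂_congr fun e he => ?_
    have := Set.ext_iff.1 hω e
    simp only [Set.mem_inter_iff, Finset.mem_coe] at this
    rw [show (e ∈ ω ↔ e ∈ ω') from ⟨fun h' => (this.1 ⟨h', he⟩).1, fun h' => (this.2 ⟨h', he⟩).1⟩]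
  -- `μ 𝒢 > 1 - 3 δ²`
  have hGprob : 1 - 3 * δ ^ 2 < μ.real Gd := by
    have hL : μ.real (lattOnly G D)ᶜ = 0 := hW.real_compl_lattOnly
    have hcov : Gdᶜ ⊆ (UniqZone.zone G Λ k n)ᶜ ∪ (linkIn (↑Qk) (Λ k) U)ᶜ ∪
        (linkIn (↑Qt) (Λ k) Ft)ᶜ ∪ (lattOnly G D)ᶜ := by
      intro ω hω
      simp only [hGd, Set.mem_compl_iff, Set.mem_inter_iff, not_and, Set.mem_union] at hω ⊢
      tauto
    have hb := (measureReal_mono hcov (μ := μ)).trans ((measureReal_union_le _ _).trans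
      (add_le_add ((measureReal_union_le _ _).trans (add_le_add (measureReal_union_le _ _) le_rfl)) le_rfl))
    rw [measureReal_compl (measurableSet_zone Λ k n), measureReal_compl (measurableSet_linkIn _ _ _),
      measureReal_compl (measurableSet_linkIn _ _ _), hL, probReal_univ, measureReal_compl hGm,
      probReal_univ] at hb
    linarith
  -- Markov: the low-conditional-probability event has mass `< 3δ`
  set F := pairsF S with hF
  have hFS : (↑F : Set (Sym2 V)) = wireSet (↑S : Set V) := coe_pairsF S
  have hMarkov := prodBernoulli_real_pinLow_le' W F hGm δ
  have hLlt : μ.real (pinLow W ↑F Gd δ) < 3 * δ := by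
    by_contra hge
    push Not at hge
    have : δ * (3 * δ) ≤ δ * μ.real (pinLow W ↑F Gd δ) := mul_le_mul_of_nonneg_left hge hδ.le
    nlinarith
  -- outside it, some `u ∈ U` is a good vertex (reliable to `T` inside `Rg`)
  have hincl : (pinLow W ↑F Gd δ)ᶜ ⊆ {ω | ∃ u ∈ U,
      1 - δ < (prodBernoulli (pinW W (wireSet (↑S : Set V)) ω)).real
        (⋃ t ∈ T, openConnIn Rg u t)} := by
    intro ω hω
    simp only [Set.mem_compl_iff, mem_pinLow_iff, not_le] at hω
    -- a configuration of `𝒢` in the cylinder of `ω`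
    have hpos : 0 < (prodBernoulli (pinW W ↑F ω)).real (Gd ∩ localCylinder ↑F ω) := by
      rw [prodBernoulli_pinW_real_inter_localCylinder W (F.finite_toSet.countable) ω Gd]
      exact lt_of_le_of_lt (sub_nonneg.2 hδ1) hω
    obtain ⟨ω₁, hω₁G, hω₁c⟩ := nonempty_of_measureReal_ne_zero (ne_of_gt hpos)
    -- the arm to `U` and the uniqueness zone, valid throughout the cylinder
    obtain ⟨⟨⟨hUZ₁, hlinkU₁⟩, -⟩, -⟩ := hω₁G
    obtain ⟨x₀, hx₀, u₀, hu₀, harm₁⟩ := hlinkU₁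
    have hKball : wireSet (↑Qk : Set V) ⊆ ↑F := by
      rw [hFS]; exact KozmaNitzan.wireSet_mono (by exact_mod_cast hQkS)
    have cyl_iff : ∀ ω' ∈ localCylinder (↑F : Set (Sym2 V)) ω, ∀ e ∈ wireSet (↑Qk : Set V),
        e ∈ ω₁ ↔ e ∈ ω' := by
      intro ω' hω' e he
      exact (hω₁c e (hKball he)).trans (hω' e (hKball he)).symm
    refine ⟨u₀, hu₀, ?_⟩
    -- `𝒢 ∩ [ω]_F ⊆ {u₀ ↔ T inside Rg}`
    have key : Gd ∩ localCylinder ↑F ω ⊆ ⋃ t ∈ T, openConnIn Rg u₀ t := by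
      rintro ω' ⟨⟨⟨⟨hUZ', -⟩, hlinkT'⟩, hlatt'⟩, hω'c⟩
      have hc := cyl_iff ω' hω'c
      -- the arm from `x₀` to `u₀` inside the kit region `Qk`, in `ω'`
      have harm' : ω' ∈ openConnIn (↑Qk) x₀ u₀ := by
        rw [DCT16.mem_openConnIn_iff_pathIn] at harm₁ ⊢
        exact KozmaNitzan.pathIn_openGraph_congr hc harm₁
      -- the route to `Ft`, exiting the cube through an edge of `G`
      obtain ⟨x', hx', t', ht', hroute⟩ := hlinkT'
      have ht'ball : t' ∉ (↑(Λ n) : Set V) := fun h' =>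
        Finset.disjoint_left.1 hfar ht' (Finset.mem_coe.1 h')
      have hx'ball : x' ∈ (↑(Λ n) : Set V) := Finset.mem_coe.2 (hkn hx')
      have hrouteIn : ω' ∈ openConnIn (↑Qt) x' t' := hroute
      rw [DCT16.mem_openConnIn_iff_pathIn] at hroute
      obtain ⟨a, b, ha, hb, hbQt, hab, hpa⟩ := hroute.exit hx'ball ht'ball
      have haQt : a ∈ (↑Qt : Set V) := hpa.right_mem.2
      -- `s(a,b)` is open inside `D`, hence an edge of `G`
      have hadj : G.Adj a b := by
        rw [openGraph_adj] at hab
        have hmem : s(a, b) ∈ pairsF D := by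
          simp only [pairsF, Finset.mem_filter, Finset.mk_mem_sym2_iff, Sym2.mk_isDiag_iff]
          exact ⟨⟨hQt (Finset.mem_coe.1 haQt), hQt (Finset.mem_coe.1 hbQt)⟩, hab.2⟩
        have := hlatt' _ hmem hab.1
        rwa [SimpleGraph.mem_edgeSet] at this
      have habdry : a ∈ innerBoundary G (Λ n) := by
        rw [mem_innerBoundary_iff]
        exact ⟨Finset.mem_coe.1 ha, b, fun h' => hb (Finset.mem_coe.2 h'), hadj⟩
      have hx'bd : ω' ∈ UniqZone.toBdry G Λ n x' := ⟨a, habdry, by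
        rw [DCT16.mem_openConnIn_iff_pathIn]; exact hpa.mono Set.inter_subset_left⟩
      -- the arm exits the zone box `Λ n` too (its end `u₀ ∈ U` lies outside), through an edge of `G`
      have hu₀ball : u₀ ∉ (↑(Λ n) : Set V) := fun h' =>
        Finset.disjoint_left.1 hUfar hu₀ (Finset.mem_coe.1 h')
      have hx₀ball : x₀ ∈ (↑(Λ n) : Set V) := Finset.mem_coe.2 (hkn hx₀)
      have harmP := harm'
      rw [DCT16.mem_openConnIn_iff_pathIn] at harmP
      obtain ⟨a₀, b₀, ha₀, hb₀, hb₀Q, hab₀, hpa₀⟩ := harmP.exit hx₀ball hu₀ball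
      have ha₀Q : a₀ ∈ (↑Qk : Set V) := hpa₀.right_mem.2
      have hadj₀ : G.Adj a₀ b₀ := by
        rw [openGraph_adj] at hab₀
        have hmem : s(a₀, b₀) ∈ pairsF D := by
          simp only [pairsF, Finset.mem_filter, Finset.mk_mem_sym2_iff, Sym2.mk_isDiag_iff]
          exact ⟨⟨hQkD (Finset.mem_coe.1 ha₀Q), hQkD (Finset.mem_coe.1 hb₀Q)⟩, hab₀.2⟩
        have := hlatt' _ hmem hab₀.1
        rwa [SimpleGraph.mem_edgeSet] at this
      have ha₀bdry : a₀ ∈ innerBoundary G (Λ n) := by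
        rw [mem_innerBoundary_iff]
        exact ⟨Finset.mem_coe.1 ha₀, b₀, fun h' => hb₀ (Finset.mem_coe.2 h'), hadj₀⟩
      have hx₀bd : ω' ∈ UniqZone.toBdry G Λ n x₀ := ⟨a₀, ha₀bdry, by
        rw [DCT16.mem_openConnIn_iff_pathIn]; exact hpa₀.mono Set.inter_subset_left⟩
      have hconn : ω' ∈ openConnIn (↑(Λ n)) x₀ x' := hUZ' x₀ hx₀ x' hx' hx₀bd hx'bd
      have hRΛ : (↑(Λ n) : Set V) ⊆ Rg := fun v hv => hRb (Finset.mem_coe.2 (hΛQk (Finset.mem_coe.1 hv)))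
      -- chain `u₀ ↔ x₀ ↔ x' ↔ t'`, all inside `Rg`
      have hmono : ∀ {A : Set V} {x y : V}, A ⊆ Rg → ω' ∈ openConnIn A x y →
          ω' ∈ openConnIn Rg x y := fun hA h => by
        rw [DCT16.mem_openConnIn_iff_pathIn] at h ⊢
        exact h.mono hA
      simp only [Set.mem_iUnion, exists_prop]
      refine ⟨t', hT ht', ?_⟩
      exact GM.openConnIn_trans (GM.openConnIn_trans (GM.openConnIn_comm.1 (hmono hRb harm'))
        (hmono hRΛ hconn)) (hmono hRQ hrouteIn)
    have hge := measureReal_mono (μ := prodBernoulli (pinW W ↑F ω)) key (measure_ne_top _ _)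
    rw [prodBernoulli_pinW_real_inter_localCylinder W (F.finite_toSet.countable) ω Gd] at hge
    rw [← hFS]
    exact hω.trans_le hge
  -- conclusion
  have hLm : MeasurableSet (pinLow W (↑F : Set (Sym2 V)) Gd δ) :=
    (determinedBy_pinLow W (↑F) Gd δ).measurableSet_of_finset
  calc 1 - 3 * δ ≤ μ.real (pinLow W ↑F Gd δ)ᶜ := by
        rw [measureReal_compl hLm, probReal_univ]; linarith

    _ ≤ μ.real {ω | ∃ u ∈ U,
          1 - δ < (prodBernoulli (pinW W (wireSet (↑S : Set V)) ω)).real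
            (⋃ t ∈ T, openConnIn Rg u t)} := measureReal_mono hincl

/-- **Step IV with the two-scale kit, `GoodVertex` form** (`Rg = univ`). [cite: KozmaNitzan2024, §4 pp. 19–21 (Step IV, (21)–(25))] -/
theorem stepIV_out' {W : Sym2 V → unitInterval} {p : unitInterval} {D S T U Qk Qt Ft : Finset V}
    (hW : IsSubbox G W p D) (hT : Ft ⊆ T) (hQt : Qt ⊆ D) (Λ : ℕ → Finset V) {k n : ℕ} (hkn : Λ k ⊆ Λ n)
    (hQkD : Qk ⊆ D) (hQkS : Qk ⊆ S) (hΛQk : Λ n ⊆ Qk) (hUfar : Disjoint U (Λ n))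
    (hfar : Disjoint Ft (Λ n)) {δ : ℝ} (hδ : 0 < δ)
    (h1 : 1 - δ ^ 2 < (prodBernoulli W).real (UniqZone.zone G Λ k n))
    (h2 : 1 - δ ^ 2 < (prodBernoulli W).real (linkIn (↑Qk) (Λ k) U))
    (h3 : 1 - δ ^ 2 < (prodBernoulli W).real (linkIn (↑Qt) (Λ k) Ft)) :
    1 - 3 * δ ≤ (prodBernoulli W).real {ω | ∃ u ∈ U, GoodVertex W S T δ ω u} := by
  refine (stepIV_out hW hT hQt Λ hkn hQkD hQkS hΛQk hUfar hfar hδ (Rg := Set.univ) (Set.subset_univ _) (Set.subset_univ _)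
    h1 h2 h3).trans (measureReal_mono ?_ (measure_ne_top _ _))
  rintro ω ⟨u, hu, h⟩
  refine ⟨u, hu, ?_⟩
  unfold GoodVertex
  simpa only [KozmaNitzan.openConnIn_univ_eq'] using h

end KNLevels

end Transplant

end Summit.CriticalPhenomena.PercolationContinuityZ3.Theorems

end
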